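import Summits.NavierStokesRegularity.NavierStokesRegularity.Theses.SelfMixingDichotomy
import Summits.NavierStokesRegularity.NavierStokesRegularity.Theorems.SelfMixingDichotomySequentialTypeIExclusionStructure
import Summits.NavierStokesRegularity.NavierStokesRegularity.Theorems.SelfMixingDichotomySequentialTypeIExclusionQuantPayoffReduction
import Summits.NavierStokesRegularity.NavierStokesRegularity.Theorems.SelfMixingDichotomyLocalToGlobal

/-!
# Crux `SelfMixingDichotomy.SequentialTypeIExclusion` (stmt-NavierStokesRegularity-1424), line `registered`:
  second admissible shape of the quantitative payoff — a FULLY MIXING HALF-BAND (helper file, `--supports`)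

Companion of `…SequentialTypeIExclusionQuantPayoffReduction.lean` / `…QuantPayoffSummit.lean`. There the payoff
P_quant assumes, on the band `[r/K, r)` below a window `C(r) ≤ M`, that every scale of Reynolds number `≥ M`
δ-mixes. Here the alternative, arguably cleaner shape for the planner:

  P_band: ∃ δ > 0 ∀ M ∃ K ≥ 2: for every classical Leray–Hopf solution (ν = 1) from a rapidly decaying datum,
  every x₀ and every scale 0 < r, r² ≤ T with C(r; T, x₀) ≤ M: if EVERY scale ρ ∈ [r/K, r/2] is δ-mixing, then
  some scale ρ ∈ [r/K, r/2] has C(ρ; T, x₀) ≤ M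

("a fully δ-mixing band of K/2 scales right below a bounded-Reynolds scale is not entirely of high Reynolds
number"). Nothing is assumed on `(r/2, r)` (where `C ≤ 4M` anyway by monotonicity) and the mixing hypothesis is
unconditional, so P_band and P_quant are incomparable; both close the route:

* `bdd_of_bandMixingPayoff` — **P_band ∧ CoherentScaleExclusion ∧ (sup-form of S1) ⇒ BDD at every final-time point**
  (same descent `cknC_typeI_of_windowStep`; the step below a window `w` is by contradiction: if no scale of
  `[w/K, w/2]` were a window, all of them would have `C ≥ M`, hence δ-mix by S2's contrapositive, and P_band would
  produce a window);
* `navierStokesRegularity_of_bandMixingPayoff` — **NavierStokesRegularity ⇐ P_band ∧ S2 ∧ ¬TypeISingularityExists**.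
-/

noncomputable section

-- the summit and its single problem share the name (D-0017 nested layout)
set_option linter.dupNamespace false

namespace Summit.NavierStokesRegularity.NavierStokesRegularity.Theorems.SequentialTypeIExclusion.Registered

open scoped ENNReal NNReal Topology
open Literature.Analysis.FluidPDE Set Filter MeasureTheory Function Metric

/-- **P_band ∧ S2 ∧ (sup-form of S1) ⇒ local boundedness at every final-time point** (fully-mixing-half-band shape
of the quantitative payoff; descent `cknC_typeI_of_windowStep`, step by contradiction, top scale
`r_s = min(r₀/2, √T)`, `M₀ = max(M, C(r_s))`, `K = K(M₀)`). -/
theorem bdd_of_bandMixingPayoff : (∃ δ : ℝ, 0 < δ ∧ ∀ M : ℝ, ∃ K : ℝ, 2 ≤ K ∧ ∀ T : ℝ, 0 < T → ∀ (u : ℝ → EuclideanSpace ℝ (Fin 3) → EuclideanSpace ℝ (Fin 3)) (p : ℝ → EuclideanSpace ℝ (Fin 3) → ℝ), Literature.Analysis.FluidPDE.IsClassicalNSSolutionOn (Set.Ico 0 T) 1 0 u p → Literature.Analysis.FluidPDE.IsLerayHopfOn T 1 0 (u 0) u → Literature.Analysis.FluidPDE.HasRapidSpatialDecay (u 0) →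 ∀ x₀ : EuclideanSpace ℝ (Fin 3), ∀ r : ℝ, 0 < r → r ^ 2 ≤ T → Literature.Analysis.FluidPDE.cknC r ((T, x₀) : ℝ × EuclideanSpace ℝ (Fin 3)) u ≤ ENNReal.ofReal M → (∀ ρ ∈ Set.Icc (r / K) (r / 2), (∀ θ : ℝ → EuclideanSpace ℝ (Fin 3) → ℝ, Literature.Analysis.FluidPDE.IsSmoothSpaceTimeOn (Set.Icc (T - ρ ^ 2) (T - ρ ^ 2 / 2)) θ → Literature.Analysis.FluidPDE.HasUniformRapidDecayOn (Set.Icc (T - ρ ^ 2) (T - ρ ^ 2 / 2)) θ → (∀ t ∈ (Set.Icc (T - ρ ^ 2) (T - ρ ^ 2 / 2)), ∀ x : EuclideanSpace ℝ (Fin 3), Literature.Analysis.FluidPDE.timeDerivWithin (Set.Icc (T - ρ ^ 2) (T - ρ ^ 2 / 2)) θ t x + inner ℝ (u t x) (gradient (θ t) x) = Laplacian.laplacian (θ t) x) → Function.support (θ (T - ρ ^ 2)) ⊆ Metric.ball x₀ ρ → ∫ x, (θ (T - ρ ^ 2 / 2) x) ^ 2 ≤ δ ^ 2 * ∫ x,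 (θ (T - ρ ^ 2) x) ^ 2)) → ∃ ρ ∈ Set.Icc (r / K) (r / 2), Literature.Analysis.FluidPDE.cknC ρ ((T, x₀) : ℝ × EuclideanSpace ℝ (Fin 3)) u ≤ ENNReal.ofReal M) → Summit.NavierStokesRegularity.NavierStokesRegularity.Theses.SelfMixingDichotomy.CoherentScaleExclusion → (∀ M : ℝ, ∀ T : ℝ, 0 < T → ∀ (u : ℝ → EuclideanSpace ℝ (Fin 3) → EuclideanSpace ℝ (Fin 3)) (p : ℝ → EuclideanSpace ℝ (Fin 3) → ℝ), Literature.Analysis.FluidPDE.IsClassicalNSSolutionOn (Set.Ico 0 T) 1 0 u p → Literature.Analysis.FluidPDE.IsLerayHopfOn T 1 0 (u 0) u → Literature.Analysis.FluidPDE.HasRapidSpatialDecay (u 0) → ∀ x₀ : EuclideanSpace ℝ (Fin 3), (∃ r₁ : ℝ, 0 < r₁ ∧ ∀ r ∈ Set.Ioo 0 r₁, Literature.Analysis.FluidPDE.cknC r ((T, x₀) : ℝ × EuclideanSpace ℝ (Fin 3)) u ≤ ENNReal.ofReal M) → ∃ ρ : ℝ, 0 < ρ ∧ ∃ M : ℝ,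 ∀ t ∈ Set.Ioo (T - ρ ^ 2) T, ∀ x ∈ Metric.ball x₀ ρ, ‖u t x‖ ≤ M) → ∀ T : ℝ, 0 < T → ∀ (u : ℝ → EuclideanSpace ℝ (Fin 3) → EuclideanSpace ℝ (Fin 3)) (p : ℝ → EuclideanSpace ℝ (Fin 3) → ℝ), Literature.Analysis.FluidPDE.IsClassicalNSSolutionOn (Set.Ico 0 T) 1 0 u p → Literature.Analysis.FluidPDE.IsLerayHopfOn T 1 0 (u 0) u → Literature.Analysis.FluidPDE.HasRapidSpatialDecay (u 0) → ∀ x₀ : EuclideanSpace ℝ (Fin 3), ∃ ρ : ℝ, 0 < ρ ∧ ∃ M : ℝ, ∀ t ∈ Set.Ioo (T - ρ ^ 2) T, ∀ x ∈ Metric.ball x₀ ρ, ‖u t x‖ ≤ M := by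
  intro hP hS2 hsup T hT u p hcl hLH hdec x₀
  obtain ⟨δ, hδ, hPδ⟩ := hP
  obtain ⟨M, hM⟩ := hS2 δ hδ
  by_contra hB
  -- S2 (contrapositive): below some `r₀`, every scale of Reynolds number `≥ M` is δ-mixing
  have h2 : ∃ r₀ : ℝ, 0 < r₀ ∧ ∀ ρ ∈ Set.Ioo 0 r₀,
      ENNReal.ofReal M ≤ Literature.Analysis.FluidPDE.cknC ρ ((T, x₀) : ℝ × EuclideanSpace ℝ (Fin 3)) u →
      (∀ θ : ℝ → EuclideanSpace ℝ (Fin 3) → ℝ, Literature.Analysis.FluidPDE.IsSmoothSpaceTimeOn (Set.Icc (T - ρ ^ 2) (T - ρ ^ 2 / 2)) θ → Literature.Analysis.FluidPDE.HasUniformRapidDecayOn (Set.Icc (T - ρ ^ 2) (T - ρ ^ 2 / 2)) θ → (∀ t ∈ (Set.Icc (T - ρ ^ 2) (T - ρ ^ 2 / 2)), ∀ x : EuclideanSpace ℝ (Fin 3), Literature.Analysis.FluidPDE.timeDerivWithin (Set.Icc (T - ρ ^ 2) (T - ρ ^ 2 / 2)) θ t x + inner ℝ (u t x) (gradient (θ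 t) x) = Laplacian.laplacian (θ t) x) → Function.support (θ (T - ρ ^ 2)) ⊆ Metric.ball x₀ ρ → ∫ x, (θ (T - ρ ^ 2 / 2) x) ^ 2 ≤ δ ^ 2 * ∫ x, (θ (T - ρ ^ 2) x) ^ 2) := by
    by_contra h
    refine hB (hM T hT u p hcl hLH hdec x₀ fun r₀ hr₀ => ?_)
    by_contra h'
    refine h ⟨r₀, hr₀, fun ρ hρ hMρ => ?_⟩
    by_contra hmix
    exact h' ⟨ρ, hρ, hMρ, hmix⟩
  obtain ⟨r₀, hr₀, hmix⟩ := h2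
  -- the top scale `r_s`
  obtain ⟨rs, hrs_pos, hrs_r₀, hrs_T⟩ : ∃ rs : ℝ, 0 < rs ∧ rs < r₀ ∧ rs ^ 2 ≤ T := by
    refine ⟨min (r₀ / 2) (Real.sqrt T), lt_min (by positivity) (Real.sqrt_pos.2 hT),
      lt_of_le_of_lt (min_le_left _ _) (by linarith), ?_⟩
    calc min (r₀ / 2) (Real.sqrt T) ^ 2 ≤ Real.sqrt T ^ 2 :=
          pow_le_pow_left₀ (le_min (by positivity) (Real.sqrt_nonneg T)) (min_le_right _ _) 2
      _ = T := Real.sq_sqrt hT.le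
  -- `M₀ = max (M, C(r_s))`, finite
  have hfin := cknC_lt_top_of_isLerayHopfOn T 1 0 (u 0) u hLH x₀ rs hrs_pos hrs_T
  set M₀ : ℝ := max M (Literature.Analysis.FluidPDE.cknC rs ((T, x₀) : ℝ × EuclideanSpace ℝ (Fin 3)) u).toReal
    with hM₀_def
  have hM₀ : Literature.Analysis.FluidPDE.cknC rs ((T, x₀) : ℝ × EuclideanSpace ℝ (Fin 3)) u ≤ ENNReal.ofReal M₀ := by
    rw [← ENNReal.ofReal_toReal hfin.ne]
    exact ENNReal.ofReal_le_ofReal (le_max_right _ _)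
  have hMM₀ : ENNReal.ofReal M ≤ ENNReal.ofReal M₀ := ENNReal.ofReal_le_ofReal (le_max_left _ _)
  obtain ⟨K, hK2, hPK⟩ := hPδ M₀
  have hK : 0 < K := by linarith
  -- one step of the descent, by contradiction
  have step : ∀ w : ℝ, 0 < w → w ≤ rs →
      Literature.Analysis.FluidPDE.cknC w ((T, x₀) : ℝ × EuclideanSpace ℝ (Fin 3)) u ≤ ENNReal.ofReal M₀ →
      ∃ w' ∈ Set.Icc (w / K) (w / 2),
        Literature.Analysis.FluidPDE.cknC w' ((T, x₀) : ℝ × EuclideanSpace ℝ (Fin 3)) u ≤ ENNReal.ofReal M₀ := by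
    intro w hw hws hCw
    by_contra hno
    refine hno (hPK T hT u p hcl hLH hdec x₀ w hw ((pow_le_pow_left₀ hw.le hws 2).trans hrs_T) hCw ?_)
    intro ρ hρ
    have hρpos : 0 < ρ := lt_of_lt_of_le (div_pos hw hK) hρ.1
    have hρr₀ : ρ < r₀ := lt_of_le_of_lt hρ.2 (by linarith [hws.trans hrs_r₀.le])
    refine hmix ρ ⟨hρpos, hρr₀⟩ (hMM₀.trans ?_)
    -- `ρ` is not a window, so `C(ρ) > M₀ ≥ M`
    by_contra hle
    exact hno ⟨ρ, hρ, (not_le.1 hle).le⟩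
  have hTI := cknC_typeI_of_windowStep u x₀ T M₀ K rs hK hrs_pos hM₀ step
  exact hB (hsup (K ^ 2 * M₀) T hT u p hcl hLH hdec x₀ ⟨rs, hrs_pos, hTI⟩)

/-- **The summit from the band-shape restated route: NavierStokesRegularity ⇐ P_band ∧ S2 ∧ ¬TypeISingularityExists**
(`bdd_of_bandMixingPayoff`, `supForm_of_not_typeISingularityExists`, `LocalToGlobal`, `NoBlowupToClay`). -/
theorem navierStokesRegularity_of_bandMixingPayoff : (∃ δ : ℝ, 0 < δ ∧ ∀ M : ℝ, ∃ K : ℝ, 2 ≤ K ∧ ∀ T : ℝ, 0 < T → ∀ (u : ℝ → EuclideanSpace ℝ (Fin 3) → EuclideanSpace ℝ (Fin 3)) (p : ℝ → EuclideanSpace ℝ (Fin 3) → ℝ), Literature.Analysis.FluidPDE.IsClassicalNSSolutionOn (Set.Ico 0 T) 1 0 u p → Literature.Analysis.FluidPDE.IsLerayHopfOn T 1 0 (u 0) u → Literature.Analysis.FluidPDE.HasRapidSpatialDecay (u 0) → ∀ x₀ : EuclideanSpace ℝ (Fin 3), ∀ r : ℝ, 0 < r → r ^ 2 ≤ T → Literature.Analysis.FluidPDE.cknC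 r ((T, x₀) : ℝ × EuclideanSpace ℝ (Fin 3)) u ≤ ENNReal.ofReal M → (∀ ρ ∈ Set.Icc (r / K) (r / 2), (∀ θ : ℝ → EuclideanSpace ℝ (Fin 3) → ℝ, Literature.Analysis.FluidPDE.IsSmoothSpaceTimeOn (Set.Icc (T - ρ ^ 2) (T - ρ ^ 2 / 2)) θ → Literature.Analysis.FluidPDE.HasUniformRapidDecayOn (Set.Icc (T - ρ ^ 2) (T - ρ ^ 2 / 2)) θ → (∀ t ∈ (Set.Icc (T - ρ ^ 2) (T - ρ ^ 2 / 2)), ∀ x : EuclideanSpace ℝ (Fin 3), Literature.Analysis.FluidPDE.timeDerivWithin (Set.Icc (T - ρ ^ 2) (T - ρ ^ 2 / 2)) θ t x + inner ℝ (u t x) (gradient (θ t) x) = Laplacian.laplacian (θ t) x) → Function.support (θ (T - ρ ^ 2)) ⊆ Metric.ball x₀ ρ → ∫ x, (θ (T - ρ ^ 2 / 2) x) ^ 2 ≤ δ ^ 2 * ∫ x, (θ (T - ρ ^ 2) x) ^ 2)) → ∃ ρ ∈ Set.Icc (r / K) (r / 2), Literature.Analysis.FluidPDE.cknC ρ ((T,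 x₀) : ℝ × EuclideanSpace ℝ (Fin 3)) u ≤ ENNReal.ofReal M) → Summit.NavierStokesRegularity.NavierStokesRegularity.Theses.SelfMixingDichotomy.CoherentScaleExclusion → ¬ Literature.Analysis.FluidPDE.TypeISingularityExists → _root_.NavierStokesRegularity :=
  fun hP hS2 hno =>
    Theses.SelfMixingDichotomy.NoBlowupToClay_holds
      (Summit.NavierStokesRegularity.NavierStokesRegularity.Theorems.selfMixingDichotomy_localToGlobal_proof
        (bdd_of_bandMixingPayoff hP hS2 (supForm_of_not_typeISingularityExists hno)))

end Summit.NavierStokesRegularity.NavierStokesRegularity.Theorems.SequentialTypeIExclusion.Registered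

end
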